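import Literature.NumberTheory.Automorphic.OrbitalIntegralKConjugacyClasses   -- ★ `orbitalIntegral_indicator_eq_toReal_lintegral` (+ ★ `OrbitalIntegralDoubleCosetUnfolding`: `conj_mem_iff_smul_mk_eq`, `finite_setOf_conj_out_ne_zero_of_isClosed`)
import Literature.MeasureTheory.Group.InvariantQuotientCompactSubgroup        -- ★ `lintegral_quotientMeasure_eq_inv_mul` (quotient by a COMPACT subgroup)
import Literature.NumberTheory.Automorphic.OrbitalMeasureCanonical            -- ★ `compactCore_eq_univ` (the canonical normalisation on a compact centraliser)
import Mathlib.Data.Real.ENatENNReal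
import HarnessLib

/-!
# The unit orbital integral at an element with COMPACT centraliser is the number of its fixed points on `G ⧸ K`:
# `O_γ(1_K) = ν(K) · #{x K ∈ G ⧸ K : γ x K = x K}`
(Rogawski, *Automorphic Representations of Unitary Groups in Three Variables* (1990), §4.9 p. 54 «`Φ(γ, f) = Σ_{x ∈ G_γ\G/K} vol(G_γ ∩ xKx⁻¹)⁻¹ f(x⁻¹γx)`»;
Laumon, *Cohomology of Drinfeld Modular Varieties* I (1996), Lemma (5.3.2): orbital integrals of units as counts of `γ`-fixed facets)

Topic `NumberTheory/Automorphic`; namespace `Literature.NumberTheory.Automorphic`.  THEOREMS ONLY (no definition, no instance, no notation, no named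
fact, no `sorry`).  Cell `pub/hodgecm-mathlib`, crux H413 = stmt-HodgeConjecture-24833, road N7 #103 non-split half (A-p06 (g25) map «D-N7-inert»
84809157 §3 (L2) ∕ §5 (D3)), LEAD F0P3a-plan (g9) WORD T8-11 (A); seat F0P3-p01 (g12).  HONEST LABEL: HC_CM is proved only modulo the printed citations
until rung 0 closes; this is the GENERIC topological-group layer (L2) of the inert unit fundamental lemma — at an inert place an elliptic `G`-regular `γ`
of `U(3)` has COMPACT centraliser `(E¹_w)³`, and the unit orbital integral for the canonical measures is then the NUMBER of `γ`-fixed hyperspecial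
vertices (self-dual lattices); the count itself (L3∕L5∕L7) is floor 2 and not here.

THE MATHEMATICS.  `G` a locally compact second countable Hausdorff group, `K ≤ G` an OPEN subgroup, `γ ∈ G`, `ν` a right-invariant (Haar) measure.
The set `S = {g ∈ G : g γ g⁻¹ ∈ K}` is the preimage of the `γ`-FIXED POINTS `Fix = {q ∈ G ⧸ K : γ • q = q}` under `g ↦ g⁻¹K` (★
`conj_mem_iff_smul_mk_eq`), and the fibre over `q` is the right coset `K · q.out⁻¹`, of measure `ν(K)`; hence (§1)
  `ν(S) = ν(K) · #Fix`                                   (`measure_setOf_conj_mem_eq_mul_encard_fixedPoints`, in `[0, ∞]` with `Set.encard`, no finiteness).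
If the centraliser `C = C_G(γ)` is COMPACT and `t` is a Haar measure on `C`, the invariant quotient measure `ν∕t` on `G ⧸ C` is `t(C)⁻¹ · π_*ν` (★
`InvariantQuotientCompactSubgroup`), and the orbital integrand of `1_K` is `1_S ∘ (lift)`, so (§2)
  `∫⁻_{G ⧸ C} 1_K(y γ y⁻¹) d(ν∕t) = t(C)⁻¹ · ν(K) · #Fix`,  `= ν(K) · #Fix` at the CANONICAL normalisation `t(C) = t(compactCore C) = 1` (★ `compactCore_eq_univ`),
and for the real orbital integral `O_γ^{ν∕t}(1_K) = ν(K) · #Fix` (`= #Fix` at `ν(K) = 1`) when `Fix` is finite (§3) — which it is whenever the class of `γ` is closed (§4: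
the fixed points lying over ONE double coset `K x C` form the `C`-orbit of `x⁻¹K`, the continuous image of the compact `C` in the DISCRETE space `G ⧸ K`, and only
finitely many double cosets meet `K`, ★ `finite_setOf_conj_out_ne_zero_of_isClosed`).

* §1 `mem_preimage_mul_out_iff`, `setOf_conj_mem_eq_biUnion_fixedPoints`, **`measure_setOf_conj_mem_eq_mul_encard_fixedPoints`**.
* §2 **`lintegral_descConj_indicator_quotientMeasure_eq_inv_mul_measure`**, **`lintegral_descConj_indicator_quotientMeasure_eq_mul_encard_fixedPoints`** (`t univ = 1`),
  `…_of_apply_compactCore_eq_one` (the canonical normalisation).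
* §3 **`orbitalIntegral_indicator_quotientMeasure_eq_mul_ncard_fixedPoints`**, **`orbitalIntegral_indicator_quotientMeasure_eq_natCard_fixedPoints`** (`ν K = 1`).
* §4 **`finite_fixedPoints_of_isClosed`**.

## References
* [Rogawski1990] J. D. Rogawski, *Automorphic Representations of Unitary Groups in Three Variables*, Ann. of Math. Stud. 123 (1990): §4.9 p. 54.
* [Laumon1995] G. Laumon, *Cohomology of Drinfeld Modular Varieties*, Part I (1996): Lemma (5.3.2) p. 136.
* [Folland1995] G. B. Folland, *A Course in Abstract Harmonic Analysis* (1995): §2.6 (2.52).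
-/

set_option autoImplicit false

noncomputable section

open MeasureTheory Measure Topology Set Filter Function
open Literature.MeasureTheory.Group
open scoped ENNReal NNReal Pointwise

namespace Literature.NumberTheory.Automorphic

/-! ## §1 `ν{g : g γ g⁻¹ ∈ K} = ν(K) · #Fix_γ(G ⧸ K)` -/

section Fixed

variable {G : Type*} [Group G] (γ : G) (K : Subgroup G)

/-- The fibre of `g ↦ g⁻¹K` over `q ∈ G ⧸ K` is the right coset `K · q.out⁻¹`: `g · q.out ∈ K ↔ g⁻¹ K = q`. [cite: Laumon1995, Lemma (5.3.2) p. 136] -/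
theorem mem_preimage_mul_out_iff (q : G ⧸ K) (g : G) :
    g ∈ (fun h : G => h * q.out) ⁻¹' (K : Set G) ↔ ((g⁻¹ : G) : G ⧸ K) = q := by
  rw [Set.mem_preimage, SetLike.mem_coe]
  conv_rhs => rw [← QuotientGroup.out_eq' q]
  rw [QuotientGroup.eq, inv_inv]

/-- **`{g : g γ g⁻¹ ∈ K}` is the disjoint union, over the `γ`-FIXED POINTS `q` of `G ⧸ K`, of the right cosets `K · q.out⁻¹`** (★ `conj_mem_iff_smul_mk_eq`:
`g γ g⁻¹ ∈ K ↔ γ` fixes `g⁻¹K`). [cite: Laumon1995, Lemma (5.3.2) p. 136] -/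
theorem setOf_conj_mem_eq_biUnion_fixedPoints :
    {g : G | g * γ * g⁻¹ ∈ K} = ⋃ q ∈ {q : G ⧸ K | γ • q = q}, (fun h : G => h * q.out) ⁻¹' (K : Set G) := by
  ext g
  simp only [Set.mem_setOf_eq, Set.mem_iUnion, exists_prop]
  constructor
  · intro hg
    exact ⟨((g⁻¹ : G) : G ⧸ K), (conj_mem_iff_smul_mk_eq γ K g).1 hg, (mem_preimage_mul_out_iff K _ g).2 rfl⟩
  · rintro ⟨q, hq, hgq⟩
    rw [mem_preimage_mul_out_iff K q g] at hgq
    rw [conj_mem_iff_smul_mk_eq, hgq]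
    exact hq

/-- The fibres over distinct points are disjoint. [cite: Laumon1995, Lemma (5.3.2) p. 136] -/
theorem pairwiseDisjoint_preimage_mul_out (s : Set (G ⧸ K)) :
    s.PairwiseDisjoint fun q : G ⧸ K => (fun h : G => h * q.out) ⁻¹' (K : Set G) := by
  intro q _ q' _ hne
  refine Set.disjoint_left.2 fun g hg hg' => hne ?_
  rw [mem_preimage_mul_out_iff K q g] at hg
  rw [mem_preimage_mul_out_iff K q' g] at hg'
  rw [← hg, ← hg']

variable [TopologicalSpace G] [IsTopologicalGroup G] [MeasurableSpace G] [BorelSpace G]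
  (ν : Measure G) [ν.IsMulRightInvariant]

/-- **`ν{g : g γ g⁻¹ ∈ K} = ν(K) · #{q ∈ G ⧸ K : γ • q = q}`** for an OPEN subgroup `K` of non-zero measure and a right-invariant `ν` — in `[0, ∞]`, with
`Set.encard` (BOTH sides are `∞` when `γ` has infinitely many fixed points): each fibre `K · q.out⁻¹` has measure `ν(K)` (right invariance), the fibres over
the fixed points are disjoint and exhaust the set. [cite: Laumon1995, Lemma (5.3.2) p. 136] [cite: Rogawski1990, §4.9 p. 54] -/
theorem measure_setOf_conj_mem_eq_mul_encard_fixedPoints (hK : IsOpen (K : Set G)) (hK0 : ν K ≠ 0) :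
    ν {g : G | g * γ * g⁻¹ ∈ K} = ν K * (({q : G ⧸ K | γ • q = q}.encard : ℕ∞) : ℝ≥0∞) := by
  have hA : ∀ q : G ⧸ K, ν ((fun h : G => h * q.out) ⁻¹' (K : Set G)) = ν K := fun q =>
    measure_preimage_mul_right ν q.out _
  have hAm : ∀ q : G ⧸ K, MeasurableSet ((fun h : G => h * q.out) ⁻¹' (K : Set G)) := fun q =>
    (hK.preimage (continuous_mul_const _)).measurableSet
  have hsum : ∀ s : Finset (G ⧸ K),
      ν (⋃ q ∈ s, (fun h : G => h * q.out) ⁻¹' (K : Set G)) = (s.card : ℝ≥0∞) * ν K := by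
    intro s
    rw [measure_biUnion_finset (pairwiseDisjoint_preimage_mul_out K (s : Set (G ⧸ K))) fun q _ => hAm q,
      Finset.sum_congr rfl fun q _ => hA q, Finset.sum_const, nsmul_eq_mul]
  rw [setOf_conj_mem_eq_biUnion_fixedPoints γ K]
  rcases ({q : G ⧸ K | γ • q = q}).finite_or_infinite with hfin | hinf
  · have hU : (⋃ q ∈ {q : G ⧸ K | γ • q = q}, (fun h : G => h * q.out) ⁻¹' (K : Set G)) =
        ⋃ q ∈ hfin.toFinset, (fun h : G => h * q.out) ⁻¹' (K : Set G) := by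
      rw [← Finset.set_biUnion_coe, hfin.coe_toFinset]
    rw [hU, hsum, hfin.encard_eq_coe_toFinset_card, ENat.toENNReal_coe, mul_comm]
  · rw [hinf.encard_eq, ENat.toENNReal_top, ENNReal.mul_top hK0]
    have hle : ∀ n : ℕ, (n : ℝ≥0∞) * ν K ≤ ν (⋃ q ∈ {q : G ⧸ K | γ • q = q}, (fun h : G => h * q.out) ⁻¹' (K : Set G)) := by
      intro n
      obtain ⟨s, hs, hcard⟩ := hinf.exists_subset_card_eq n
      rw [← hcard, ← hsum s, ← Finset.set_biUnion_coe]
      exact measure_mono (Set.biUnion_subset_biUnion_left hs)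
    by_contra htop
    obtain ⟨n, hn⟩ := ENNReal.exists_nat_mul_gt hK0 htop
    exact absurd (hle n) (not_le.2 hn)

end Fixed

/-! ## §2 The `[0, ∞]`-valued orbital integral of `1_K` at a COMPACT centraliser -/

section Quotient

variable {G : Type*} [Group G] [TopologicalSpace G] [IsTopologicalGroup G] [LocallyCompactSpace G]
  [SecondCountableTopology G] [T2Space G] [MeasurableSpace G] [BorelSpace G]
  (γ : G) (K : Subgroup G)
  [MeasurableSpace (G ⧸ Subgroup.centralizer ({γ} : Set G))]
  [BorelSpace (G ⧸ Subgroup.centralizer ({γ} : Set G))]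
  [hC : IsClosed ((Subgroup.centralizer ({γ} : Set G) : Subgroup G) : Set G)]
  (t : Measure (Subgroup.centralizer ({γ} : Set G))) [t.IsMulLeftInvariant]
  [IsFiniteMeasureOnCompacts t] [t.IsOpenPosMeasure] [t.IsInvInvariant] [SFinite t]
  (ν : Measure G) [IsHaarMeasure ν] [ν.IsMulRightInvariant]
  [CompactSpace (Subgroup.centralizer ({γ} : Set G))]

/- `hC` is ★ `isClosed_coe_centralizer_singleton γ` (Mathlib `Set.isClosed_centralizer`); `CompactSpace C` ↔ `IsCompact (C : Set G)`
(`isCompact_iff_compactSpace`). -/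

/-- **`∫⁻_{G ⧸ C} 1_K(y γ y⁻¹) d(ν∕t) = t(C)⁻¹ · ν{g : g γ g⁻¹ ∈ K}`** for a COMPACT centraliser `C = C_G(γ)` and `K` open: the quotient measure by a
compact subgroup is `t(C)⁻¹ · π_* ν` (★ `lintegral_quotientMeasure_eq_inv_mul`) and the orbital integrand of `1_K` lifts to `1_{{g γ g⁻¹ ∈ K}}`.
[cite: Folland1995, §2.6 (2.52)] [cite: Rogawski1990, §4.9 p. 54] -/
theorem lintegral_descConj_indicator_quotientMeasure_eq_inv_mul_measure (hK : IsOpen (K : Set G)) :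
    ∫⁻ y, descConj γ (Subgroup.centralizer ({γ} : Set G))
        (fun _ hg => Subgroup.mem_centralizer_singleton_iff.1 hg)
          ((K : Set G).indicator (1 : G → ℝ≥0∞)) y
          ∂quotientMeasure (Subgroup.centralizer ({γ} : Set G)) t hC ν =
      (t Set.univ)⁻¹ * ν {g : G | g * γ * g⁻¹ ∈ K} := by
  have hS : MeasurableSet {g : G | g * γ * g⁻¹ ∈ K} :=
    (hK.preimage ((continuous_id.mul continuous_const).mul continuous_id.inv)).measurableSet
  rw [lintegral_quotientMeasure_eq_inv_mul (Subgroup.centralizer ({γ} : Set G)) t ν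
      (measurable_descConj γ _ _ (measurable_one.indicator hK.measurableSet)),
    ← lintegral_indicator_one hS]
  -- the lifted integrand `g ↦ 1_K(g γ g⁻¹)` IS `1_{{g | g γ g⁻¹ ∈ K}}` (definitionally)
  rfl

/-- **`∫⁻_{G ⧸ C} 1_K(y γ y⁻¹) d(ν∕t) = t(C)⁻¹ · ν(K) · #Fix_γ(G ⧸ K)`** (compact centraliser, `K` open; `[0, ∞]`-valued, no finiteness hypothesis).
[cite: Rogawski1990, §4.9 p. 54] [cite: Laumon1995, Lemma (5.3.2) p. 136] -/
theorem lintegral_descConj_indicator_quotientMeasure_eq_inv_mul_mul_encard_fixedPoints (hK : IsOpen (K : Set G)) :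
    ∫⁻ y, descConj γ (Subgroup.centralizer ({γ} : Set G))
        (fun _ hg => Subgroup.mem_centralizer_singleton_iff.1 hg)
          ((K : Set G).indicator (1 : G → ℝ≥0∞)) y
          ∂quotientMeasure (Subgroup.centralizer ({γ} : Set G)) t hC ν =
      (t Set.univ)⁻¹ * (ν K * (({q : G ⧸ K | γ • q = q}.encard : ℕ∞) : ℝ≥0∞)) := by
  rw [lintegral_descConj_indicator_quotientMeasure_eq_inv_mul_measure γ K t ν hK,
    measure_setOf_conj_mem_eq_mul_encard_fixedPoints γ K ν hK (hK.measure_ne_zero ν ⟨1, K.one_mem⟩)]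

/-- **THE FIXED-POINT COUNT: `∫⁻_{G ⧸ C} 1_K(y γ y⁻¹) d(ν∕t) = ν(K) · #{q ∈ G ⧸ K : γ • q = q}`** for a COMPACT centraliser `C = C_G(γ)` carrying a Haar
measure `t` of TOTAL MASS ONE (the canonical normalisation: `compactCore C = C`), `K` an open subgroup, `ν` a Haar measure — in `[0, ∞]` with `Set.encard`,
no finiteness hypothesis.  Print: «`Φ(γ, f) = Σ_{x ∈ G_γ\G∕K} vol(G_γ ∩ xKx⁻¹)⁻¹ f(x⁻¹ γ x)`» (p. 54) at `f = 1_K`: for compact `G_γ` of mass one each weight is the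
size of the `G_γ`-orbit of the fixed point `x⁻¹K`, and the double cosets enumerate the orbits. [cite: Rogawski1990, §4.9 p. 54] [cite: Laumon1995, Lemma (5.3.2) p. 136] -/
theorem lintegral_descConj_indicator_quotientMeasure_eq_mul_encard_fixedPoints (hK : IsOpen (K : Set G)) (ht : t Set.univ = 1) :
    ∫⁻ y, descConj γ (Subgroup.centralizer ({γ} : Set G))
        (fun _ hg => Subgroup.mem_centralizer_singleton_iff.1 hg)
          ((K : Set G).indicator (1 : G → ℝ≥0∞)) y
          ∂quotientMeasure (Subgroup.centralizer ({γ} : Set G)) t hC ν =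
      ν K * (({q : G ⧸ K | γ • q = q}.encard : ℕ∞) : ℝ≥0∞) := by
  rw [lintegral_descConj_indicator_quotientMeasure_eq_inv_mul_mul_encard_fixedPoints γ K t ν hK, ht, inv_one, one_mul]

omit [IsFiniteMeasureOnCompacts t] [t.IsOpenPosMeasure] [t.IsInvInvariant] [SFinite t] [t.IsMulLeftInvariant]
  [IsTopologicalGroup G] [LocallyCompactSpace G] [SecondCountableTopology G] [T2Space G] [BorelSpace G] hC
  [MeasurableSpace (G ⧸ Subgroup.centralizer ({γ} : Set G))] [BorelSpace (G ⧸ Subgroup.centralizer ({γ} : Set G))]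
  [IsHaarMeasure ν] [ν.IsMulRightInvariant] in
/-- At a compact centraliser the CANONICAL normalisation `t(compactCore C) = 1` (★ `OrbitalMeasureFamily.IsCanonical`) is `t(C) = 1` (★ `compactCore_eq_univ`).
[cite: Rogawski1990, §4.3 (4.3.1) p. 43] -/
theorem measure_univ_eq_one_of_apply_compactCore_eq_one (ht : t (compactCore (Subgroup.centralizer ({γ} : Set G))) = 1) :
    t Set.univ = 1 := by
  rwa [compactCore_eq_univ] at ht

/-! ## §3 The real orbital integral `O_γ^{ν∕t}(1_K)` as a natural number -/

/-- **`O_γ^{ν∕t}(1_K) = ν(K) · #{q ∈ G ⧸ K : γ • q = q}`** (real orbital integral ★ `orbitalIntegral`, compact centraliser of `t`-mass one, `K` open, finitely many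
fixed points — e.g. at a closed class, `finite_fixedPoints_of_isClosed`). [cite: Rogawski1990, §4.9 p. 54] [cite: Laumon1995, Lemma (5.3.2) p. 136] -/
theorem orbitalIntegral_indicator_quotientMeasure_eq_mul_ncard_fixedPoints (hK : IsOpen (K : Set G)) (ht : t Set.univ = 1)
    (hfin : {q : G ⧸ K | γ • q = q}.Finite) :
    orbitalIntegral γ ((K : Set G).indicator (1 : G → ℝ)) (quotientMeasure (Subgroup.centralizer ({γ} : Set G)) t hC ν) =
      (ν K).toReal * ({q : G ⧸ K | γ • q = q}.ncard : ℝ) := by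
  rw [orbitalIntegral_indicator_eq_toReal_lintegral γ K hK,
    lintegral_descConj_indicator_quotientMeasure_eq_mul_encard_fixedPoints γ K t ν hK ht, ENNReal.toReal_mul,
    hfin.encard_eq_coe_toFinset_card, ENat.toENNReal_coe, ENNReal.toReal_natCast, Set.ncard_eq_toFinset_card _ hfin]

/-- **`O_γ^{ν∕t}(1_K) = #{q ∈ G ⧸ K : γ • q = q}`** at the unit normalisations `ν(K) = 1`, `t(C) = 1` — «the number of `γ`-fixed points of `G ⧸ K`» (hyperspecial
vertices, self-dual lattices, … fixed by `γ`). [cite: Rogawski1990, §4.9 p. 54] [cite: Laumon1995, Lemma (5.3.2) p. 136] -/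
theorem orbitalIntegral_indicator_quotientMeasure_eq_natCard_fixedPoints (hK : IsOpen (K : Set G)) (ht : t Set.univ = 1) (hν : ν K = 1)
    (hfin : {q : G ⧸ K | γ • q = q}.Finite) :
    orbitalIntegral γ ((K : Set G).indicator (1 : G → ℝ)) (quotientMeasure (Subgroup.centralizer ({γ} : Set G)) t hC ν) =
      (Nat.card {q : G ⧸ K | γ • q = q} : ℝ) := by
  rw [orbitalIntegral_indicator_quotientMeasure_eq_mul_ncard_fixedPoints γ K t ν hK ht hfin, hν, ENNReal.toReal_one, one_mul,
    Nat.card_coe_set_eq]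

end Quotient

/-! ## §4 Finiteness of the fixed-point set at a closed class -/

section Finite

variable {G : Type*} [Group G] [TopologicalSpace G] [IsTopologicalGroup G] [LocallyCompactSpace G]
  [SecondCountableTopology G] [T2Space G] (γ : G) (K : Subgroup G)

/-- **At a CLOSED class with COMPACT centraliser, `γ` has finitely many fixed points on `G ⧸ K`** (`K` compact open): the fixed points lying over one
double coset `K x C_G(γ)` form the `C_G(γ)`-orbit `{c x⁻¹ K}` of `x⁻¹K` — the continuous image of the compact `C_G(γ)` in the DISCRETE space `G ⧸ K`
(Mathlib `QuotientGroup.discreteTopology`), hence finite — and only finitely many double cosets carry a fixed point (★ `finite_setOf_conj_out_ne_zero_of_isClosed`: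
«there are finitely many `G_γ(F)`-orbits in `(G(F)·σ) ∩ 𝓕(γ)`»). [cite: Laumon1995, Lemma (5.3.2) p. 136] -/
theorem finite_fixedPoints_of_isClosed (hO : IsClosed {g | ∃ y : G, y * γ * y⁻¹ = g}) (hK : IsOpen (K : Set G))
    (hKc : IsCompact (K : Set G)) (hCc : IsCompact ((Subgroup.centralizer ({γ} : Set G) : Subgroup G) : Set G)) :
    {q : G ⧸ K | γ • q = q}.Finite := by
  haveI : DiscreteTopology (G ⧸ K) := QuotientGroup.discreteTopology hK
  haveI : CompactSpace (Subgroup.centralizer ({γ} : Set G)) := isCompact_iff_compactSpace.mp hCc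
  -- the finitely many double cosets `K x C` with `x γ x⁻¹ ∈ K`
  have hfs : HasCompactSupport ((K : Set G).indicator (1 : G → ℝ)) :=
    HasCompactSupport.intro hKc fun g hg => Set.indicator_of_notMem hg _
  have hfinq := finite_setOf_conj_out_ne_zero_of_isClosed γ K hO hK hfs
  -- the orbit of `x⁻¹K` under the compact centraliser is finite (compact in a discrete space)
  have horb : ∀ x : G, (Set.range fun c : Subgroup.centralizer ({γ} : Set G) => (((c : G) * x⁻¹ : G) : G ⧸ K)).Finite := fun x =>
    (isCompact_range (QuotientGroup.continuous_mk.comp (continuous_subtype_val.mul continuous_const))).finite_of_discrete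
  refine (hfinq.biUnion fun q _ => horb q.out).subset ?_
  rintro p hp
  obtain ⟨y, rfl⟩ := QuotientGroup.mk_surjective p
  -- `γ • yK = yK`, i.e. `y⁻¹ γ y ∈ K`
  have h1 : γ • (((y⁻¹)⁻¹ : G) : G ⧸ K) = (((y⁻¹)⁻¹ : G) : G ⧸ K) := by
    rw [inv_inv]
    exact hp
  have hy : y⁻¹ * γ * y⁻¹⁻¹ ∈ K := (conj_mem_iff_smul_mk_eq γ K y⁻¹).2 h1
  rw [inv_inv] at hy
  obtain ⟨k, c, hk, hc, hout⟩ := DoubleCoset.mk_out_eq_mul K (Subgroup.centralizer ({γ} : Set G)) y⁻¹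
  have hcγ : c * γ * c⁻¹ = γ := by
    rw [Subgroup.mem_centralizer_singleton_iff.1 hc, mul_inv_cancel_right]
  simp only [Set.mem_iUnion, Set.mem_setOf_eq, Set.mem_range, exists_prop]
  refine ⟨DoubleCoset.mk K (Subgroup.centralizer ({γ} : Set G)) y⁻¹, ?_, ⟨c, hc⟩, ?_⟩
  · -- `q.out γ q.out⁻¹ = k (y⁻¹ γ y) k⁻¹ ∈ K`
    rw [hout]
    have h2 : k * y⁻¹ * c * γ * (k * y⁻¹ * c)⁻¹ = k * (y⁻¹ * (c * γ * c⁻¹) * y) * k⁻¹ := by group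
    rw [h2, hcγ, Set.indicator_of_mem (show k * (y⁻¹ * γ * y) * k⁻¹ ∈ (K : Set G) from
      K.mul_mem (K.mul_mem hk hy) (K.inv_mem hk)), Pi.one_apply]
    exact one_ne_zero
  · -- `c • q.out⁻¹ K = yK`
    rw [hout, QuotientGroup.eq]
    have h3 : ((c : G) * (k * y⁻¹ * c)⁻¹)⁻¹ * y = k := by group
    rw [h3]
    exact hk

end Finite

end Literature.NumberTheory.Automorphic

end
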